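import Mathlib
import Summits.CriticalPhenomena.CardyFormulaZ2.Theorems.CardySelfRefinementGradientComparabilityStubNonAxialShareBulkTopology
import HarnessLib

/-!
# Local surgery on crossings of a quad by the open edges of `δℤ²`: topological toolkit, II

Helper file for the stub `stub_nonAxialShare_bulk` (D4-bulk) of the line `Sketch` (crux
`stmt-CriticalPhenomena-10269`, `…Theses.CardySelfRefinement.GradientComparability`), second half
of the configuration-free plane topology (continuing `…StubNonAxialShareBulkTopology.lean`):

* **rerouting** `crossing_reroute` (registered sub-goal): if `ρ ⊆ ρ' ∪ R`, the drawing of `R`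
  avoids `∂₀Q ∪ ∂₂Q`, and a continuum `P ⊆ [Q]` inside the drawing of `ρ'` contains every point
  where the drawings of `ρ'` and `R` meet, then every crossing of `Q` inside the drawing of `ρ`
  yields one inside the drawing of `ρ'` — the old crossing off `R`, patched with `P`
  (`isPreconnected_inter_union_patch`); and the trivial variant when `R` is drawn off `[Q]`;
* isolated vertices and isolated open edges (`meshPoint_notMem_openEdgeUnion`,
  `subset_segment_of_isolated_edge`);
* bulk geometry: a ball meeting no side of `Q` lies in the interior of `[Q]` or off `[Q]`
  (`ball_subset_interior_or_disjoint`), coordinate bound for drawn distances, disjointness of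
  the segments of vertex-disjoint edges;
* links to the sides (`∃ a ∈ ∂_jQ, JoinedIn ([Q] ∩ openEdgeUnion δ σ) a (δx)`): monotonicity,
  isolated points, two links give a crossing, and **`not_crossing_of_links`** — the contrapositive
  of the three-way decomposition in both orientations `{jp, jq} = {0, 2}`.

No percolation, no named fact.
-/

noncomputable section

namespace Summit.CriticalPhenomena.CardyFormulaZ2.Theorems.CardySelfRefinement

open scoped Topology
open Filter Set MeasureTheory Metric
open Literature.Probability.LatticeModels Literature.Probability.Percolation
open Literature.Probability.Percolation.QuadCrossing

variable {D : Set ℂ} {δ : ℝ}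


/-! ## Rerouting a crossing through a patch -/

/-- **Patching lemma.**  Let `K ⊆ O' ∪ D_R` be preconnected (`O'`, `D_R` closed) and meet `D_R`,
and let the preconnected patch `P` contain `K ∩ O' ∩ D_R`.  Then `(K ∩ O') ∪ P` is
preconnected. -/
theorem isPreconnected_inter_union_patch {K O' DR P : Set ℂ} (hK : IsPreconnected K)
    (hKsub : K ⊆ O' ∪ DR) (hO' : IsClosed O') (hDR : IsClosed DR) (hP : IsPreconnected P)
    (hKP : K ∩ O' ∩ DR ⊆ P) (hKDR : (K ∩ DR).Nonempty) : IsPreconnected (K ∩ O' ∪ P) := by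
  set S := K ∩ O' ∪ P with hS
  -- one-sided version: the patch misses `C₂`
  have key : ∀ C₁ C₂ : Set ℂ, IsClosed C₁ → IsClosed C₂ → S ⊆ C₁ ∪ C₂ → (S ∩ C₂).Nonempty →
      (∀ z ∈ P, z ∉ C₂) → (S ∩ (C₁ ∩ C₂)).Nonempty := by
    intro C₁ C₂ hC₁ hC₂ hSC hSC₂ hPC₂
    obtain ⟨z₀, hz₀S, hz₀C₂⟩ := hSC₂
    have hz₀K : z₀ ∈ K ∩ O' := by
      rcases hz₀S with h | h
      · exact h
      · exact absurd hz₀C₂ (hPC₂ z₀ h)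
    have hKcov : K ⊆ (C₁ ∪ DR) ∪ (C₂ ∩ O') := fun k hk => by
      by_cases hkO : k ∈ O'
      · rcases hSC (Or.inl ⟨hk, hkO⟩) with h | h
        · exact Or.inl (Or.inl h)
        · exact Or.inr ⟨h, hkO⟩
      · exact Or.inl (Or.inr ((hKsub hk).resolve_left hkO))
    obtain ⟨z, hzK, hz1, hz2⟩ := isPreconnected_closed_iff.1 hK _ _ (hC₁.union hDR)
      (hC₂.inter hO') hKcov (let ⟨y, hyK, hyD⟩ := hKDR; ⟨y, hyK, Or.inr hyD⟩)
      ⟨z₀, hz₀K.1, hz₀C₂, hz₀K.2⟩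
    rcases hz1 with hzC₁ | hzD
    · exact ⟨z, Or.inl ⟨hzK, hz2.2⟩, hzC₁, hz2.1⟩
    · exact absurd hz2.1 (hPC₂ z (hKP ⟨⟨hzK, hz2.2⟩, hzD⟩))
  rw [isPreconnected_closed_iff]
  intro C₁ C₂ hC₁ hC₂ hSC hSC₁ hSC₂
  by_contra hcon
  rw [Set.not_nonempty_iff_eq_empty] at hcon
  -- the patch lies in `C₁ ∪ C₂` and cannot meet both
  have hPcov : P ⊆ C₁ ∪ C₂ := fun z hz => hSC (Or.inr hz)
  by_cases hP₂ : (P ∩ C₂).Nonempty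
  · by_cases hP₁ : (P ∩ C₁).Nonempty
    · obtain ⟨z, hzP, hz⟩ := isPreconnected_closed_iff.1 hP _ _ hC₁ hC₂ hPcov hP₁ hP₂
      have : z ∈ S ∩ (C₁ ∩ C₂) := ⟨Or.inr hzP, hz⟩
      rw [hcon] at this
      exact this
    · have h := key C₂ C₁ hC₂ hC₁ (by rwa [Set.union_comm]) hSC₁
        (fun z hz hz1 => hP₁ ⟨z, hz, hz1⟩)
      rw [Set.inter_comm C₂, hcon] at h
      exact Set.not_nonempty_empty h
  · have h := key C₁ C₂ hC₁ hC₂ hSC hSC₂ (fun z hz hz2 => hP₂ ⟨z, hz, hz2⟩)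
    rw [hcon] at h
    exact Set.not_nonempty_empty h

/-- **Rerouting.**  Let `ρ ⊆ ρ' ∪ R`, let the drawing of `R` avoid `∂₀Q ∪ ∂₂Q`, and let `P` be a
continuum inside `[Q]` and inside the drawing of `ρ'` containing every point where the drawings of
`ρ'` and `R` meet.  Then every crossing of `Q` inside the drawing of `ρ` yields one inside the
drawing of `ρ'` (the part of the old crossing off `R`, patched with `P`). -/
theorem crossing_reroute {D : Set ℂ} {δ : ℝ} (hδ : 0 < δ) (Q : Quad D) {ρ ρ' R : BondConfig (Site 2)}
    (hsub : ρ ⊆ ρ' ∪ R) {P : Set ℂ} (hPc : IsCompact P) (hPconn : IsPreconnected P)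
    (hPQ : P ⊆ Q.carrier) (hPO : P ⊆ openEdgeUnion δ ρ')
    (hRP : ∀ z ∈ openEdgeUnion δ ρ', z ∈ openEdgeUnion δ R → z ∈ P)
    (hR : ∀ z ∈ openEdgeUnion δ R, z ∉ Q.side 0 ∧ z ∉ Q.side 2)
    (hcr : ∃ K, Q.IsCrossing K ∧ K ⊆ openEdgeUnion δ ρ) :
    ∃ K, Q.IsCrossing K ∧ K ⊆ openEdgeUnion δ ρ' := by
  obtain ⟨K, ⟨hKc, hKconn, hKQ, ⟨x₀, hx₀K, hx₀⟩, ⟨x₂, hx₂K, hx₂⟩⟩, hKρ⟩ := hcr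
  set O' := openEdgeUnion δ ρ' with hO'
  set DR := openEdgeUnion δ R with hDR
  have hO'c : IsClosed O' := isClosed_openEdgeUnion hδ ρ'
  have hDRc : IsClosed DR := isClosed_openEdgeUnion hδ R
  have hKsub : K ⊆ O' ∪ DR := hKρ.trans (openEdgeUnion_subset_union_of_subset δ hsub)
  have hx₀O : x₀ ∈ O' := (hKsub hx₀K).resolve_right fun h => (hR x₀ h).1 hx₀
  have hx₂O : x₂ ∈ O' := (hKsub hx₂K).resolve_right fun h => (hR x₂ h).2 hx₂
  by_cases hKDR : (K ∩ DR).Nonempty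
  · refine ⟨K ∩ O' ∪ P, ⟨(hKc.inter_right hO'c).union hPc, ⟨⟨x₀, Or.inl ⟨hx₀K, hx₀O⟩⟩,
      isPreconnected_inter_union_patch hKconn.isPreconnected hKsub hO'c hDRc hPconn
        (fun z ⟨⟨_, hzO⟩, hzD⟩ => hRP z hzO hzD) hKDR⟩, ?_, ⟨x₀, Or.inl ⟨hx₀K, hx₀O⟩, hx₀⟩,
      ⟨x₂, Or.inl ⟨hx₂K, hx₂O⟩, hx₂⟩⟩, ?_⟩
    · rintro z (⟨hzK, -⟩ | hzP)
      exacts [hKQ hzK, hPQ hzP]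
    · rintro z (⟨-, hzO⟩ | hzP)
      exacts [hzO, hPO hzP]
  · rw [Set.not_nonempty_iff_eq_empty] at hKDR
    refine ⟨K, ⟨hKc, hKconn, hKQ, ⟨x₀, hx₀K, hx₀⟩, ⟨x₂, hx₂K, hx₂⟩⟩, fun z hz => ?_⟩
    exact (hKsub hz).resolve_right fun h => by
      have : z ∈ K ∩ DR := ⟨hz, h⟩
      rw [hKDR] at this
      exact this

/-- If the drawing of `R` misses `[Q]` altogether, closing `R` (and opening anything) keeps every
crossing. -/
theorem crossing_of_subset_union_of_disjoint (δ : ℝ) (Q : Quad D) {ρ ρ' R : BondConfig (Site 2)}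
    (hsub : ρ ⊆ ρ' ∪ R) (hR : ∀ z ∈ openEdgeUnion δ R, z ∉ Q.carrier)
    (hcr : ∃ K, Q.IsCrossing K ∧ K ⊆ openEdgeUnion δ ρ) :
    ∃ K, Q.IsCrossing K ∧ K ⊆ openEdgeUnion δ ρ' := by
  obtain ⟨K, hK, hKρ⟩ := hcr
  exact ⟨K, hK, fun z hz => (openEdgeUnion_subset_union_of_subset δ hsub (hKρ hz)).resolve_right
    fun h => hR z h (hK.2.2.1 hz)⟩

/-! ## Isolated vertices and isolated edges -/

/-- The drawn point of a lattice point with no open edge at it is off the drawing. -/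
theorem meshPoint_notMem_openEdgeUnion (hδ : 0 < δ) {ω : BondConfig (Site 2)} {v : Site 2}
    (h : ∀ y, (zdGraph 2).Adj v y → s(v, y) ∉ ω) : meshPoint δ v ∉ openEdgeUnion δ ω := fun hv => by
  obtain ⟨y, hy, hω⟩ := exists_adj_mem_of_meshPoint_mem hδ hv
  exact h y hy hω

/-- The drawing of the single edge `{c, a}` is (inside) its segment. -/
theorem openEdgeUnion_singleton_subset (δ : ℝ) (c a : Site 2) :
    openEdgeUnion δ {s(c, a)} ⊆ segment ℝ (meshPoint δ c) (meshPoint δ a) := by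
  intro z hz
  obtain ⟨x, y, -, hxy, hzs⟩ := mem_openEdgeUnion_iff.1 hz
  rcases Sym2.eq_iff.1 (Set.mem_singleton_iff.1 hxy) with ⟨h1, h2⟩ | ⟨h1, h2⟩
  · rw [← h1, ← h2]; exact hzs
  · rw [← h1, ← h2, segment_symm]; exact hzs

/-- **An isolated open edge traps continua.**  If the open edge `{c, a}` is the only open edge at
`c` and at `a`, then a preconnected subset of the drawing meeting its segment lies inside the
segment (the rest of the drawing is a closed set disjoint from the segment). -/
theorem subset_segment_of_isolated_edge (hδ : 0 < δ) {τ : BondConfig (Site 2)} {c a : Site 2}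
    (hca : (zdGraph 2).Adj c a)
    (hc : ∀ y, (zdGraph 2).Adj c y → s(c, y) ∈ τ → y = a)
    (ha : ∀ y, (zdGraph 2).Adj a y → s(a, y) ∈ τ → y = c)
    {K : Set ℂ} (hK : IsPreconnected K) (hKO : K ⊆ openEdgeUnion δ τ)
    (hKseg : (K ∩ segment ℝ (meshPoint δ c) (meshPoint δ a)).Nonempty) :
    K ⊆ segment ℝ (meshPoint δ c) (meshPoint δ a) := by
  set seg := segment ℝ (meshPoint δ c) (meshPoint δ a) with hseg
  set O₁ := openEdgeUnion δ (τ \ {s(c, a)}) with hO₁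
  have hcov : openEdgeUnion δ τ ⊆ O₁ ∪ seg := by
    refine (openEdgeUnion_subset_union_of_subset δ (R := {s(c, a)}) (ω' := τ \ {s(c, a)})
      fun e he => ?_).trans (Set.union_subset_union_right _ (openEdgeUnion_singleton_subset δ c a))
    by_cases h : e = s(c, a)
    · exact Or.inr h
    · exact Or.inl ⟨he, h⟩
  have hdisj : ∀ z ∈ seg, z ∉ O₁ := fun z hz hzO => by
    have hz' : z ∈ openEdgeUnion δ {s(c, a)} := mem_openEdgeUnion_iff.2 ⟨c, a, hca, rfl, hz⟩
    obtain ⟨v, -, ⟨y, -, hvS⟩, ⟨y', hvy', hvT⟩⟩ :=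
      exists_vertex_of_mem_inter hδ (S := {s(c, a)}) (T := τ \ {s(c, a)})
        (fun e he hT => hT.2 he) hz' hzO
    rcases Sym2.eq_iff.1 (Set.mem_singleton_iff.1 hvS) with ⟨h1, -⟩ | ⟨h1, -⟩
    · subst h1
      have := hc y' hvy' hvT.1
      subst this
      exact hvT.2 rfl
    · subst h1
      have := ha y' hvy' hvT.1
      subst this
      exact hvT.2 Sym2.eq_swap
  have hO₁c : IsClosed O₁ := isClosed_openEdgeUnion hδ _
  have hsegc : IsClosed seg := (isCompact_segment_complex _ _).isClosed
  have hKcov : K ⊆ O₁ ∪ seg := hKO.trans hcov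
  by_contra hnot
  obtain ⟨z, hzK, hzseg⟩ := Set.not_subset.1 hnot
  have hzO : z ∈ O₁ := (hKcov hzK).resolve_right hzseg
  obtain ⟨w, -, hwO, hwseg⟩ := isPreconnected_closed_iff.1 hK _ _ hO₁c hsegc hKcov ⟨z, hzK, hzO⟩
    hKseg
  exact hdisj w hwseg hwO


/-! ## Geometry of the bulk: balls off the sides, segments near a point -/

/-- A point of the interior of `[Q]` lies on no side of `Q`. -/
theorem notMem_side_of_mem_interior (Q : Quad D) {z : ℂ} (hz : z ∈ interior Q.carrier)
    (j : Fin 4) : z ∉ Q.side j := fun h =>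
  ((Q.side_subset_frontier j) h).2 hz

/-- A ball meeting no side of `Q` lies inside the interior of `[Q]` or off `[Q]`. -/
theorem ball_subset_interior_or_disjoint (Q : Quad D) {z : ℂ} {r : ℝ}
    (hfar : ∀ j : Fin 4, ∀ p ∈ Q.side j, r ≤ dist z p) :
    Metric.ball z r ⊆ interior Q.carrier ∨ ∀ w ∈ Metric.ball z r, w ∉ Q.carrier := by
  have hfr : ∀ w ∈ Metric.ball z r, w ∉ frontier Q.carrier := fun w hw hwf => by
    rw [Q.frontier_carrier] at hwf
    have hlt : dist z w < r := by rw [dist_comm]; exact hw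
    rcases hwf with ((h | h) | h) | h
    · exact absurd (hfar 0 w h) (not_le.2 hlt)
    · exact absurd (hfar 1 w h) (not_le.2 hlt)
    · exact absurd (hfar 2 w h) (not_le.2 hlt)
    · exact absurd (hfar 3 w h) (not_le.2 hlt)
  have hcl : IsClosed Q.carrier := Q.isCompact_carrier.isClosed
  have hcov : Metric.ball z r ⊆ interior Q.carrier ∪ Q.carrierᶜ := fun w hw => by
    by_cases hwQ : w ∈ Q.carrier
    · left
      by_contra hwi
      exact hfr w hw ⟨by rw [hcl.closure_eq]; exact hwQ, hwi⟩
    · exact Or.inr hwQ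
  have hpc : IsPreconnected (Metric.ball z r) := (convex_ball z r).isPreconnected
  by_cases hne : (Metric.ball z r ∩ interior Q.carrier).Nonempty
  · exact Or.inl (hpc.subset_left_of_subset_union isOpen_interior hcl.isOpen_compl
      (Set.disjoint_left.2 fun w hw hwc => hwc (interior_subset hw)) hcov hne)
  · right
    intro w hw hwQ
    rcases hcov hw with h | h
    · exact hne ⟨w, hw, h⟩
    · exact h hwQ

/-- Distance of two drawn lattice points in terms of the coordinates (`δ ≥ 0`). -/
theorem dist_meshPoint_le (hδ : 0 ≤ δ) (x y : Site 2) :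
    dist (meshPoint δ x) (meshPoint δ y) ≤ δ * (|((x 0 : ℤ) : ℝ) - y 0| + |((x 1 : ℤ) : ℝ) - y 1|) := by
  rw [dist_eq_norm]
  have hre : (meshPoint δ x - meshPoint δ y).re = δ * ((x 0 : ℝ) - y 0) := by
    simp only [Complex.sub_re, meshPoint_re]; ring
  have him : (meshPoint δ x - meshPoint δ y).im = δ * ((x 1 : ℝ) - y 1) := by
    simp only [Complex.sub_im, meshPoint_im]; ring
  calc ‖meshPoint δ x - meshPoint δ y‖
      ≤ |(meshPoint δ x - meshPoint δ y).re| + |(meshPoint δ x - meshPoint δ y).im| :=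
        Complex.norm_le_abs_re_add_abs_im _
    _ = δ * (|((x 0 : ℤ) : ℝ) - y 0| + |((x 1 : ℤ) : ℝ) - y 1|) := by
        rw [hre, him, abs_mul, abs_mul, abs_of_nonneg hδ]; ring

/-- The drawing of a configuration all of whose (genuine) edges are drawn inside `T` lies in
`T`. -/
theorem openEdgeUnion_subset_of_forall {δ : ℝ} {S : BondConfig (Site 2)} {T : Set ℂ}
    (h : ∀ x y, (zdGraph 2).Adj x y → s(x, y) ∈ S → segment ℝ (meshPoint δ x) (meshPoint δ y) ⊆ T) :
    openEdgeUnion δ S ⊆ T := fun z hz => by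
  obtain ⟨x, y, hxy, hS, hz⟩ := mem_openEdgeUnion_iff.1 hz
  exact h x y hxy hS hz

/-- Distinct lattice edges without a common end have disjoint drawn segments (`δ ≠ 0`). -/
theorem segment_disjoint_of_ne (hδ : δ ≠ 0) {x y x' y' : Site 2} (hxy : (zdGraph 2).Adj x y)
    (hxy' : (zdGraph 2).Adj x' y') (h1 : x ≠ x') (h2 : x ≠ y') (h3 : y ≠ x') (h4 : y ≠ y')
    {z : ℂ} (hz : z ∈ segment ℝ (meshPoint δ x) (meshPoint δ y))
    (hz' : z ∈ segment ℝ (meshPoint δ x') (meshPoint δ y')) : False := by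
  have hne : s(x, y) ≠ s(x', y') := fun h => by
    rcases Sym2.eq_iff.1 h with ⟨rfl, -⟩ | ⟨rfl, -⟩
    · exact h1 rfl
    · exact h2 rfl
  obtain ⟨v, -, hv, hv'⟩ := exists_eq_meshPoint_of_mem_segment_inter hδ hxy hxy' hne hz hz'
  rcases Sym2.mem_iff.1 hv with rfl | rfl <;> rcases Sym2.mem_iff.1 hv' with h | h
  exacts [h1 h, h2 h, h3 h, h4 h]

/-! ## Links to the sides: elementary facts -/

/-- Links are monotone in the configuration. -/
theorem joinedIn_mono_config (δ : ℝ) (Q : Quad D) {τ σ : BondConfig (Site 2)} (h : τ ⊆ σ)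
    {a b : ℂ} (hJ : JoinedIn (Q.carrier ∩ openEdgeUnion δ τ) a b) :
    JoinedIn (Q.carrier ∩ openEdgeUnion δ σ) a b :=
  hJ.mono (Set.inter_subset_inter_right _ (openEdgeUnion_mono δ h))

/-- Links to a set of points are monotone in the configuration. -/
theorem link_mono (δ : ℝ) (Q : Quad D) {τ σ : BondConfig (Site 2)} (h : τ ⊆ σ) {S : Set ℂ}
    {z : ℂ} (hL : ∃ a ∈ S, JoinedIn (Q.carrier ∩ openEdgeUnion δ τ) a z) :
    ∃ a ∈ S, JoinedIn (Q.carrier ∩ openEdgeUnion δ σ) a z :=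
  let ⟨a, ha, hJ⟩ := hL; ⟨a, ha, joinedIn_mono_config δ Q h hJ⟩

/-- A lattice point with no open edge at it is joined to nothing. -/
theorem not_joinedIn_of_isolated (hδ : 0 < δ) (Q : Quad D) {τ : BondConfig (Site 2)} {x : Site 2}
    (hx : ∀ y, (zdGraph 2).Adj x y → s(x, y) ∉ τ) (a : ℂ) :
    ¬ JoinedIn (Q.carrier ∩ openEdgeUnion δ τ) a (meshPoint δ x) := fun hJ =>
  meshPoint_notMem_openEdgeUnion hδ hx hJ.mem.2.2

/-- A point joined to `∂_{jp}Q` and to `∂_{jq}Q` (`{jp, jq} = {0, 2}`) gives a crossing. -/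
theorem crossing_of_two_links (Q : Quad D) {F : Set ℂ} {jp jq : Fin 4}
    (hj : (jp = 0 ∧ jq = 2) ∨ (jp = 2 ∧ jq = 0)) {z : ℂ}
    (hp : ∃ a ∈ Q.side jp, JoinedIn F a z) (hq : ∃ b ∈ Q.side jq, JoinedIn F b z) :
    ∃ a ∈ Q.side 0, ∃ b ∈ Q.side 2, JoinedIn F a b := by
  obtain ⟨a, ha, hJa⟩ := hp
  obtain ⟨b, hb, hJb⟩ := hq
  rcases hj with ⟨rfl, rfl⟩ | ⟨rfl, rfl⟩
  · exact ⟨a, ha, b, hb, hJa.trans hJb.symm⟩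
  · exact ⟨b, hb, a, ha, hJb.trans hJa.symm⟩

/-- **No crossing from the link classes** (contrapositive of the three-way decomposition, in
both orientations `{jp, jq} = {0, 2}`).  If `τ` does not cross `Q`, no end of `Sp` is joined in
`τ` to `∂_{jq}Q`, no end of `Sq` to `∂_{jp}Q`, and no end of `Sp` to an end of `Sq`, then
`τ ∪ Sp ∪ Sq` does not cross `Q`. -/
theorem not_crossing_of_links (hδ : 0 < δ) (Q : Quad D) {τ Sp Sq : BondConfig (Site 2)}
    {jp jq : Fin 4} (hj : (jp = 0 ∧ jq = 2) ∨ (jp = 2 ∧ jq = 0))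
    (hτ : ¬ ∃ a ∈ Q.side 0, ∃ b ∈ Q.side 2, JoinedIn (Q.carrier ∩ openEdgeUnion δ τ) a b)
    (hτp : ∀ e ∈ Sp, e ∉ τ) (hτq : ∀ e ∈ Sq, e ∉ τ)
    (hAB : ∀ z ∈ openEdgeUnion δ Sp, z ∉ openEdgeUnion δ Sq)
    (hbulk : ∀ z ∈ openEdgeUnion δ (Sp ∪ Sq), z ∉ Q.side 0 ∧ z ∉ Q.side 2)
    (hVp : ∀ x x', (zdGraph 2).Adj x x' → s(x, x') ∈ Sp →
      ¬ ∃ b ∈ Q.side jq, JoinedIn (Q.carrier ∩ openEdgeUnion δ τ) b (meshPoint δ x))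
    (hVq : ∀ y y', (zdGraph 2).Adj y y' → s(y, y') ∈ Sq →
      ¬ ∃ a ∈ Q.side jp, JoinedIn (Q.carrier ∩ openEdgeUnion δ τ) a (meshPoint δ y))
    (hJ : ∀ x x' y y', (zdGraph 2).Adj x x' → s(x, x') ∈ Sp → (zdGraph 2).Adj y y' →
      s(y, y') ∈ Sq → ¬ JoinedIn (Q.carrier ∩ openEdgeUnion δ τ) (meshPoint δ x) (meshPoint δ y)) :
    ¬ ∃ a ∈ Q.side 0, ∃ b ∈ Q.side 2, JoinedIn (Q.carrier ∩ openEdgeUnion δ (τ ∪ Sp ∪ Sq)) a b := by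
  intro hcr
  rcases hj with ⟨rfl, rfl⟩ | ⟨rfl, rfl⟩
  · rcases crossing_decomposition hδ Q hτp hτq hAB hbulk hcr with h | ⟨x, ⟨x', hxx', hx⟩, hL⟩ |
        ⟨y, ⟨y', hyy', hy⟩, hL⟩ | ⟨x, y, ⟨x', hxx', hx⟩, ⟨y', hyy', hy⟩, hJ'⟩
    · exact hτ h
    · exact hVp x x' hxx' hx hL
    · exact hVq y y' hyy' hy hL
    · exact hJ x x' y y' hxx' hx hyy' hy hJ'
  · have hcr' : ∃ a ∈ Q.side 0, ∃ b ∈ Q.side 2,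
        JoinedIn (Q.carrier ∩ openEdgeUnion δ (τ ∪ Sq ∪ Sp)) a b := by
      rwa [Set.union_assoc, Set.union_comm Sq, ← Set.union_assoc]
    have hAB' : ∀ z ∈ openEdgeUnion δ Sq, z ∉ openEdgeUnion δ Sp := fun z hz hz' => hAB z hz' hz
    have hbulk' : ∀ z ∈ openEdgeUnion δ (Sq ∪ Sp), z ∉ Q.side 0 ∧ z ∉ Q.side 2 := by
      rw [Set.union_comm]; exact hbulk
    rcases crossing_decomposition hδ Q hτq hτp hAB' hbulk' hcr' with h | ⟨x, ⟨x', hxx', hx⟩, hL⟩ |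
        ⟨y, ⟨y', hyy', hy⟩, hL⟩ | ⟨x, y, ⟨x', hxx', hx⟩, ⟨y', hyy', hy⟩, hJ'⟩
    · exact hτ h
    · exact hVq x x' hxx' hx hL
    · exact hVp y y' hyy' hy hL
    · exact hJ y y' x x' hyy' hy hxx' hx hJ'.symm

end Summit.CriticalPhenomena.CardyFormulaZ2.Theorems.CardySelfRefinement

end
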